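import Summits.AtomisticToContinuum.Crystallization.Theorems.OverbindingBudgetAffineRunCutCrossPatch

/-!
# «RunCut» C-XASM: the pair bookkeeping of a letter-slipped competitor and the JOINT letter-averaging assembly

Support file (lens-4 g87, hand-in 3 item 2 «C-XASM» of critic row 1544 (b); memo `g87/memo/SW-CHI.md` §6).  Generic, dictionary-free: a finite
configuration `y : Fin N → E3`, a patch label `π i : Option K` per site (`none` = static), per-site letter displacements `w i : Fin 3 → E3`, and for a
joint letter assignment `ℓ : K → Fin 3` the competitor `slip y π w ℓ i = y i + w i (ℓ k)` on patch `k`, `= y i` on static sites.  Then, for ANY pair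
potential `V`:
* `interactionEnergy_slip_sub` — `𝓔(yℓ) − 𝓔(y) = Σ_{i<j} Δ_ij(ℓ)` (pairs of static sites contribute `0`);
* `sum_letters_pairDelta` — summed over ALL `3^{#K}` assignments a pair contributes `#(K → Fin 3)` times its CLASS AVERAGE `avgDelta`: `0`
  (static–static), the 3-average over the mover's letter (mover–static, `three_mul_sum_letters`), the 3-average over the common letter (same patch), the
  9-average over two independent letters (different patches, `nine_mul_sum_letters`) — the disjoint pair-class decomposition C-XASM asks for;
* ★ `sum_letters_energy` — `Σ_ℓ (𝓔(yℓ) − 𝓔(y)) = #(K → Fin 3) · Σ_{i<j} avgDelta_ij`;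
* ★ `exists_letters_energy_le` — some assignment does at least as well as the average: `∃ ℓ, 𝓔(yℓ) ≤ 𝓔(y) + Σ_{i<j} avgDelta_ij`, and
  `exists_letters_energy_le_of_bounds` with termwise class bounds `avgDelta_ij ≤ B i j`.
The analytic class bounds are the tree's `avg_lennardJones_sub_le` (3-average, …RunCutForgone) and `avg9_lennardJones_sub_le` (9-average, …RunCutCrossPatch);
the per-column lines (ideal gain, chirality, c/a, roughness) enter through `B`.  §4: the mover clause of SW♭ (`mover_clause`: moved ⇒ eligible ∧
moved by `≤ R i`) and the injectivity of `yℓ` (`slip_injective`) from ABSTRACT hypotheses — the geometric ones (letter vectors shorter than the distance to every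
other site; no mover–mover collision) are what S1 `…RunCutSlipMap` discharges from the charts.
[this file: 4 definitions (`disp`, `slip`, `pairDelta`, `avgDelta`), 13 theorems; standard axioms]
-/

noncomputable section

namespace Summit.AtomisticToContinuum.Crystallization.Theorems.OverbindingBudgetAffineRunCutPairBook

open Finset
open Literature.MathematicalPhysics.StatisticalMechanics (interactionEnergy)
open Summit.AtomisticToContinuum.Crystallization.Theorems.ChargedEnergyGapNegative (E3)
open Summit.AtomisticToContinuum.Crystallization.Theorems.OverbindingBudgetAffineRunCutCrossPatch

variable {N : ℕ} {K : Type*}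

/-! ## §1. The letter-slipped configuration -/

/-- The displacement of site `i` under the joint letter assignment `ℓ`: `w i (ℓ k)` on patch `k`, `0` on a static site. -/
def disp (π : Fin N → Option K) (w : Fin N → Fin 3 → E3) (ℓ : K → Fin 3) (i : Fin N) : E3 :=
  (π i).elim 0 fun k => w i (ℓ k)

/-- **The competitor** `yℓ = y + disp`. -/
def slip (y : Fin N → E3) (π : Fin N → Option K) (w : Fin N → Fin 3 → E3) (ℓ : K → Fin 3) : Fin N → E3 :=
  fun i => y i + disp π w ℓ i

/-- The change of the pair term `(i, j)`. -/
def pairDelta (V : ℝ → ℝ) (y : Fin N → E3) (π : Fin N → Option K) (w : Fin N → Fin 3 → E3) (ℓ : K → Fin 3) (i j : Fin N) : ℝ :=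
  V (dist (slip y π w ℓ i) (slip y π w ℓ j)) - V (dist (y i) (y j))

/-- Static sites do not move. [this file · kind: proof] -/
theorem slip_of_static {y : Fin N → E3} {π : Fin N → Option K} {w : Fin N → Fin 3 → E3} {ℓ : K → Fin 3} {i : Fin N} (h : π i = none) :
    slip y π w ℓ i = y i := by
  simp [slip, disp, h]

/-- On patch `k` the site moves by its own letter displacement. [this file · kind: proof] -/
theorem slip_of_patch {y : Fin N → E3} {π : Fin N → Option K} {w : Fin N → Fin 3 → E3} {ℓ : K → Fin 3} {i : Fin N} {k : K} (h : π i = some k) :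
    slip y π w ℓ i = y i + w i (ℓ k) := by
  simp [slip, disp, h]

/-- **Mover clause, set side**: a site that moved lies on some patch. [this file · kind: proof] -/
theorem exists_patch_of_slip_ne {y : Fin N → E3} {π : Fin N → Option K} {w : Fin N → Fin 3 → E3} {ℓ : K → Fin 3} {i : Fin N}
    (h : slip y π w ℓ i ≠ y i) : ∃ k, π i = some k := by
  rcases hπ : π i with _ | k
  · exact absurd (slip_of_static hπ) h
  · exact ⟨k, rfl⟩

/-- **Mover clause, metric side**: the displacement of a patch site is the norm of its letter vector. [this file · kind: proof] -/
theorem dist_slip_self {y : Fin N → E3} {π : Fin N → Option K} {w : Fin N → Fin 3 → E3} {ℓ : K → Fin 3} {i : Fin N} {k : K} (h : π i = some k) :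
    dist (slip y π w ℓ i) (y i) = ‖w i (ℓ k)‖ := by
  rw [slip_of_patch h, dist_eq_norm, add_sub_cancel_left]

/-! ## §2. Pair bookkeeping -/

/-- **`𝓔(yℓ) − 𝓔(y) = Σ_{i<j} Δ_ij(ℓ)`.** [this file · kind: proof] -/
theorem interactionEnergy_slip_sub (V : ℝ → ℝ) (y : Fin N → E3) (π : Fin N → Option K) (w : Fin N → Fin 3 → E3) (ℓ : K → Fin 3) :
    interactionEnergy V (slip y π w ℓ) - interactionEnergy V y = ∑ i, ∑ j ∈ Ioi i, pairDelta V y π w ℓ i j := by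
  simp only [interactionEnergy, pairDelta, Finset.sum_sub_distrib]

/-- Pairs of static sites contribute nothing. [this file · kind: proof] -/
theorem pairDelta_static {V : ℝ → ℝ} {y : Fin N → E3} {π : Fin N → Option K} {w : Fin N → Fin 3 → E3} (ℓ : K → Fin 3) {i j : Fin N}
    (hi : π i = none) (hj : π j = none) : pairDelta V y π w ℓ i j = 0 := by
  simp [pairDelta, slip_of_static hi, slip_of_static hj]

variable [DecidableEq K]

/-- **The class average of the pair term `(i, j)`**: `0` (static–static) · 3-average over the mover's letter (mover–static) · 3-average over the
common letter (same patch) · 9-average over two independent letters (different patches). -/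
def avgDelta (V : ℝ → ℝ) (y : Fin N → E3) (π : Fin N → Option K) (w : Fin N → Fin 3 → E3) (i j : Fin N) : ℝ :=
  (π i).elim
    ((π j).elim 0 fun _ => 1 / 3 * ∑ b : Fin 3, (V (dist (y i) (y j + w j b)) - V (dist (y i) (y j))))
    fun k => (π j).elim (1 / 3 * ∑ a : Fin 3, (V (dist (y i + w i a) (y j)) - V (dist (y i) (y j))))
      fun k' => if k = k' then 1 / 3 * ∑ a : Fin 3, (V (dist (y i + w i a) (y j + w j a)) - V (dist (y i) (y j)))
        else 1 / 9 * ∑ p : Fin 3 × Fin 3, (V (dist (y i + w i p.1) (y j + w j p.2)) - V (dist (y i) (y j)))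

/-- The class average of a static–static pair is `0` (so its bound may be taken `0`). [this file · kind: proof] -/
theorem avgDelta_static {V : ℝ → ℝ} {y : Fin N → E3} {π : Fin N → Option K} {w : Fin N → Fin 3 → E3} {i j : Fin N}
    (hi : π i = none) (hj : π j = none) : avgDelta V y π w i j = 0 := by
  simp [avgDelta, hi, hj]

variable [Fintype K]

/-- **The pair-class decomposition under the product of the letter choices**: `Σ_ℓ Δ_ij(ℓ) = #(K → Fin 3) · avgDelta_ij`. [this file · kind: proof] -/
theorem sum_letters_pairDelta (V : ℝ → ℝ) (y : Fin N → E3) (π : Fin N → Option K) (w : Fin N → Fin 3 → E3) (i j : Fin N) :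
    ∑ ℓ : K → Fin 3, pairDelta V y π w ℓ i j = Fintype.card (K → Fin 3) * avgDelta V y π w i j := by
  rcases hi : π i with _ | k <;> rcases hj : π j with _ | k'
  · simp [pairDelta, avgDelta, slip, disp, hi, hj]
  · have h3 := three_mul_sum_letters (K := K) k' (fun b => V (dist (y i) (y j + w j b)) - V (dist (y i) (y j)))
    beta_reduce at h3
    simp only [pairDelta, avgDelta, slip, disp, hi, hj, Option.elim, add_zero]
    linear_combination (1 / 3 : ℝ) * h3
  · have h3 := three_mul_sum_letters (K := K) k (fun a => V (dist (y i + w i a) (y j)) - V (dist (y i) (y j)))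
    beta_reduce at h3
    simp only [pairDelta, avgDelta, slip, disp, hi, hj, Option.elim, add_zero]
    linear_combination (1 / 3 : ℝ) * h3
  · simp only [pairDelta, avgDelta, slip, disp, hi, hj, Option.elim]
    by_cases hkk : k = k'
    · rw [if_pos hkk]
      subst hkk
      have h3 := three_mul_sum_letters (K := K) k (fun a => V (dist (y i + w i a) (y j + w j a)) - V (dist (y i) (y j)))
      beta_reduce at h3
      linear_combination (1 / 3 : ℝ) * h3
    · rw [if_neg hkk]
      have h9 := nine_mul_sum_letters (K := K) (i := k) (j := k') (Ne.symm hkk)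
        (fun a b => V (dist (y i + w i a) (y j + w j b)) - V (dist (y i) (y j)))
      beta_reduce at h9
      linear_combination (1 / 9 : ℝ) * h9

/-! ## §3. ★ The assembly -/

/-- ★ **`Σ_ℓ (𝓔(yℓ) − 𝓔(y)) = #(K → Fin 3) · Σ_{i<j} avgDelta_ij`.** [this file · kind: proof] -/
theorem sum_letters_energy (V : ℝ → ℝ) (y : Fin N → E3) (π : Fin N → Option K) (w : Fin N → Fin 3 → E3) :
    ∑ ℓ : K → Fin 3, (interactionEnergy V (slip y π w ℓ) - interactionEnergy V y)
      = Fintype.card (K → Fin 3) * ∑ i, ∑ j ∈ Ioi i, avgDelta V y π w i j := by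
  simp_rw [interactionEnergy_slip_sub]
  rw [Finset.sum_comm, Finset.mul_sum]
  refine Finset.sum_congr rfl fun i _ => ?_
  rw [Finset.sum_comm, Finset.mul_sum]
  exact Finset.sum_congr rfl fun j _ => sum_letters_pairDelta V y π w i j

/-- ★ **SOME JOINT LETTER ASSIGNMENT DOES AT LEAST AS WELL AS THE AVERAGE**: `∃ ℓ, 𝓔(yℓ) ≤ 𝓔(y) + Σ_{i<j} avgDelta_ij`. [this file · kind: proof] -/
theorem exists_letters_energy_le (V : ℝ → ℝ) (y : Fin N → E3) (π : Fin N → Option K) (w : Fin N → Fin 3 → E3) :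
    ∃ ℓ : K → Fin 3, interactionEnergy V (slip y π w ℓ) ≤ interactionEnergy V y + ∑ i, ∑ j ∈ Ioi i, avgDelta V y π w i j := by
  obtain ⟨ℓ, hℓ⟩ := exists_letters_le (K := K) (F := fun ℓ => interactionEnergy V (slip y π w ℓ) - interactionEnergy V y)
    (A := ∑ i, ∑ j ∈ Ioi i, avgDelta V y π w i j) (sum_letters_energy V y π w).le
  exact ⟨ℓ, by linarith⟩

/-- ★ **Assembly with termwise class bounds**: if every pair class average is bounded, `avgDelta_ij ≤ B i j` (`i < j`), some assignment has
`𝓔(yℓ) ≤ 𝓔(y) + Σ_{i<j} B i j`. [this file · kind: proof] -/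
theorem exists_letters_energy_le_of_bounds (V : ℝ → ℝ) (y : Fin N → E3) (π : Fin N → Option K) (w : Fin N → Fin 3 → E3) (B : Fin N → Fin N → ℝ)
    (hB : ∀ i j, i < j → avgDelta V y π w i j ≤ B i j) :
    ∃ ℓ : K → Fin 3, interactionEnergy V (slip y π w ℓ) ≤ interactionEnergy V y + ∑ i, ∑ j ∈ Ioi i, B i j := by
  obtain ⟨ℓ, hℓ⟩ := exists_letters_energy_le V y π w
  have hle : ∑ i, ∑ j ∈ Ioi i, avgDelta V y π w i j ≤ ∑ i, ∑ j ∈ Ioi i, B i j :=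
    Finset.sum_le_sum fun i _ => Finset.sum_le_sum fun j hj => hB i j (Finset.mem_Ioi.1 hj)
  exact ⟨ℓ, hℓ.trans (by linarith)⟩

/-! ## §4. The mover clause and injectivity, abstract (the geometric hypotheses are S1's) -/

omit [DecidableEq K] [Fintype K] in
/-- **Mover clause of SW♭, abstract**: if every patch site is eligible (`P i`) and every letter vector of a patch site is at most `R i` long, then every
moved site is eligible and moved by at most `R i`. [this file · kind: proof] -/
theorem mover_clause {y : Fin N → E3} {π : Fin N → Option K} {w : Fin N → Fin 3 → E3} {P : Fin N → Prop} {R : Fin N → ℝ}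
    (hP : ∀ i k, π i = some k → P i) (hR : ∀ i k, π i = some k → ∀ a, ‖w i a‖ ≤ R i) (ℓ : K → Fin 3) (i : Fin N)
    (h : slip y π w ℓ i ≠ y i) : P i ∧ dist (slip y π w ℓ i) (y i) ≤ R i := by
  obtain ⟨k, hk⟩ := exists_patch_of_slip_ne h
  exact ⟨hP i k hk, by rw [dist_slip_self hk]; exact hR i k hk (ℓ k)⟩

omit [DecidableEq K] [Fintype K] in
/-- **Injectivity of the competitor, abstract**: `y` injective, every letter vector of a patch site SHORTER than the distance to every other site
(mover–static collisions), and no two distinct patch sites landing on the same point for any letters (mover–mover collisions — the chart geometry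
of S1) ⇒ `yℓ` is injective for every assignment. [this file · kind: proof] -/
theorem slip_injective {y : Fin N → E3} {π : Fin N → Option K} {w : Fin N → Fin 3 → E3} (hy : Function.Injective y)
    (h1 : ∀ i k, π i = some k → ∀ a, ∀ j, j ≠ i → ‖w i a‖ < dist (y i) (y j))
    (h2 : ∀ i j k k', i ≠ j → π i = some k → π j = some k' → ∀ a b, y i + w i a ≠ y j + w j b) (ℓ : K → Fin 3) :
    Function.Injective (slip y π w ℓ) := by
  intro i j hij
  by_contra hne
  rcases hi : π i with _ | k <;> rcases hj : π j with _ | k'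
  · rw [slip_of_static hi, slip_of_static hj] at hij
    exact hne (hy hij)
  · rw [slip_of_static hi, slip_of_patch hj] at hij
    have hlt := h1 j k' hj (ℓ k') i hne
    have hd : dist (y j) (y i) = ‖w j (ℓ k')‖ := by
      rw [hij, dist_comm, dist_eq_norm, add_sub_cancel_left]
    rw [hd] at hlt
    exact lt_irrefl _ hlt
  · rw [slip_of_patch hi, slip_of_static hj] at hij
    have hlt := h1 i k hi (ℓ k) j (Ne.symm hne)
    have hd : dist (y i) (y j) = ‖w i (ℓ k)‖ := by
      rw [← hij, dist_comm, dist_eq_norm, add_sub_cancel_left]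
    rw [hd] at hlt
    exact lt_irrefl _ hlt
  · rw [slip_of_patch hi, slip_of_patch hj] at hij
    exact h2 i j k k' hne hi hj (ℓ k) (ℓ k') hij

end Summit.AtomisticToContinuum.Crystallization.Theorems.OverbindingBudgetAffineRunCutPairBook

end
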